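import Literature.Computability.Cryptography.RealReducedPairsDivisorThreshold
import Literature.NumberTheory.QuadraticFields.ScholzMirrorTorsionWitnessTools
import Literature.Computability.Complexity.Randomized
import Literature.Computability.Complexity.StackUnaryBits
import Mathlib.SetTheory.Cardinal.Finite
import HarnessLib

/-!
# Crux `ArithStatLadder.IqThreeMemBQP` (stmt-QuantumAdvantage-2424), line `scholz-mirror-siegel` — the yes-side count of the real sampler (support of stub S6b)

Support file of the registered stub `stub_realWitnessOfParts` (S6b). Two counting facts behind the yes side of
the real torsion-witness sampler. (1) `exists_goodPairs`: in a real quadratic field `F ∋ α`, `α² = d₀`, if every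
ideal class meets `≥ ρ` reduced pairs `(a, b)` of `D = d_F` (the hypothesis `(R1)` of the stub, one class at a
time) then the reduced pairs whose class has order divisible by `3` AND whose `M_b = (D − b²)/4` has `≤ K'²`
divisors number at least `#{C : 3 ∣ ord C} · ρ − 2√D(1 + log D)³/K'` (fibrewise count `Finset.card_eq_sum_card_fiberwise`
and the divisor threshold `RealReducedPairs.threshold_mul_card_le_sqrt_mul_log`). (2) `coin_injection`: coin
strings of length `β' ≥ ℓ + k` whose first `ℓ` bits spell `b` and next `k` bits spell an index `J(a, b)`, over a
set of pairs on which `(b, J)` is injective, have uniform probability `≥ #pairs / 2^(ℓ+k)` (the injection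
`((a, b), t) ↦ natBits ℓ b ++ natBits k J ++ t`).
-/

set_option linter.dupNamespace false -- D-0017: single-problem summit ⇒ QuantumAdvantage.QuantumAdvantage by design

noncomputable section

namespace Summit.QuantumAdvantage.QuantumAdvantage.Theorems.ArithStatLadder.IqThreeMemBQP

open scoped NumberField nonZeroDivisors
open _root_.Computability Finset
open Literature.Computability.Complexity Literature.Computability.Cryptography
open Literature.NumberTheory.QuadraticFields

/-! ### Good reduced pairs -/

/-- **The good reduced pairs.** `F` real quadratic, `α ∈ 𝓞 F` with `α² = d₀`; if every class `C` is the class of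
`span{fmtA, fmtR + α}` for at least `ρ` reduced pairs `(a, b)` of `D = d_F` (`(fmtA, fmtR) = (a, b/2)` if `4 ∣ D`,
else `(2a, b)`), then at least `#{C : 3 ∣ ord C} · ρ − 2√D(1+log D)³/K'` reduced pairs have a class of order divisible
by `3` and `τ((D − b²)/4) ≤ K'²`. [cite: JacobsonWilliams2008, Thm. 5.8] -/
theorem exists_goodPairs {F : Type} [Field F] [NumberField F] (h2 : Module.finrank ℚ F = 2)
    (hpos : 0 < NumberField.discr F) (α : 𝓞 F) {ρ : ℝ}
    (hR1 : ∀ C : ClassGroup (𝓞 F), ρ ≤ Nat.card {ab : ℕ × ℕ // (0 < ab.1 ∧ 0 < ab.2 ∧ ab.2 ^ 2 < (NumberField.discr F).toNat ∧ 4 * ab.1 ∣ (NumberField.discr F).toNat - ab.2 ^ 2 ∧ (NumberField.discr F).toNat < (2 * ab.1 + ab.2) ^ 2 ∧ (2 * ab.1 ≤ ab.2 ∨ (2 * ab.1 - ab.2) ^ 2 < (NumberField.discr F).toNat)) ∧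
      ∃ hI : Ideal.span {((if 4 ∣ (NumberField.discr F).toNat then ab.1 else 2 * ab.1 : ℕ) : 𝓞 F), ((if 4 ∣ (NumberField.discr F).toNat then ab.2 / 2 else ab.2 : ℕ) : 𝓞 F) + α} ∈ (Ideal (𝓞 F))⁰, ClassGroup.mk0 ⟨_, hI⟩ = C})
    {K' : ℕ} (hK' : 0 < K') :
    ∃ GR : Finset (ℕ × ℕ), (∀ ab ∈ GR, (0 < ab.1 ∧ 0 < ab.2 ∧ ab.2 ^ 2 < (NumberField.discr F).toNat ∧ 4 * ab.1 ∣ (NumberField.discr F).toNat - ab.2 ^ 2 ∧ (NumberField.discr F).toNat < (2 * ab.1 + ab.2) ^ 2 ∧ (2 * ab.1 ≤ ab.2 ∨ (2 * ab.1 - ab.2) ^ 2 < (NumberField.discr F).toNat)) ∧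
      (∃ hI : Ideal.span {((if 4 ∣ (NumberField.discr F).toNat then ab.1 else 2 * ab.1 : ℕ) : 𝓞 F), ((if 4 ∣ (NumberField.discr F).toNat then ab.2 / 2 else ab.2 : ℕ) : 𝓞 F) + α} ∈ (Ideal (𝓞 F))⁰, 3 ∣ orderOf (ClassGroup.mk0 ⟨_, hI⟩)) ∧
      (((NumberField.discr F).toNat - ab.2 ^ 2) / 4).divisors.card ≤ K' ^ 2) ∧
    ((univ.filter fun C : ClassGroup (𝓞 F) => 3 ∣ orderOf C).card : ℝ) * ρ -
      2 * (Real.sqrt (NumberField.discr F).toNat * (1 + Real.log (NumberField.discr F).toNat) ^ 3) / K' ≤ GR.card := by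
  classical
  obtain ⟨RP, hRP⟩ := RealReducedPairs.exists_finset (NumberField.discr F).toNat
  -- the class of a pair (junk `1` when `a = 0`)
  set Cab : ℕ × ℕ → ClassGroup (𝓞 F) := fun ab => if h : 0 < ab.1 then ClassGroup.mk0 ⟨Ideal.span {((if 4 ∣ (NumberField.discr F).toNat then ab.1 else 2 * ab.1 : ℕ) : 𝓞 F), ((if 4 ∣ (NumberField.discr F).toNat then ab.2 / 2 else ab.2 : ℕ) : 𝓞 F) + α},
    span_pair_natCast_mem_nonZeroDivisors (show 0 < (if 4 ∣ (NumberField.discr F).toNat then ab.1 else 2 * ab.1 : ℕ) by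
      split_ifs <;> omega) _⟩ else 1 with hCab
  have hCab_pos : ∀ ab : ℕ × ℕ, 0 < ab.1 → ∀ hI : Ideal.span {((if 4 ∣ (NumberField.discr F).toNat then ab.1 else 2 * ab.1 : ℕ) : 𝓞 F), ((if 4 ∣ (NumberField.discr F).toNat then ab.2 / 2 else ab.2 : ℕ) : 𝓞 F) + α} ∈ (Ideal (𝓞 F))⁰, Cab ab = ClassGroup.mk0 ⟨_, hI⟩ := by
    intro ab hab hI
    simp only [hCab, dif_pos hab]
  set S3 := (univ.filter fun C : ClassGroup (𝓞 F) => 3 ∣ orderOf C) with hS3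
  set GOOD := RP.filter fun ab => 3 ∣ orderOf (Cab ab) with hGOOD
  set LOST := RP.filter fun ab => K' ^ 2 < ((((NumberField.discr F).toNat) - ab.2 ^ 2) / 4).divisors.card with hLOST
  set GR := GOOD.filter fun ab => ((((NumberField.discr F).toNat) - ab.2 ^ 2) / 4).divisors.card ≤ K' ^ 2 with hGR
  -- (1) every class of order divisible by `3` carries `≥ ρ` reduced pairs
  have hfib : ∀ C ∈ S3, ρ ≤ ((GOOD.filter fun ab => Cab ab = C).card : ℝ) := by
    intro C hC
    have h3C : 3 ∣ orderOf C := (mem_filter.1 hC).2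
    have hset : (GOOD.filter fun ab => Cab ab = C) = RP.filter fun ab => Cab ab = C := by
      ext ab
      simp only [hGOOD, mem_filter]
      exact ⟨fun h => ⟨h.1.1, h.2⟩, fun h => ⟨⟨h.1, h.2 ▸ h3C⟩, h.2⟩⟩
    rw [hset, ← Nat.subtype_card (RP.filter fun ab => Cab ab = C) (fun ab => ?_)]
    · exact hR1 C
    · rw [mem_filter, hRP]
      constructor
      · rintro ⟨hred, hC'⟩
        have hI : Ideal.span {((if 4 ∣ (NumberField.discr F).toNat then ab.1 else 2 * ab.1 : ℕ) : 𝓞 F), ((if 4 ∣ (NumberField.discr F).toNat then ab.2 / 2 else ab.2 : ℕ) : 𝓞 F) + α} ∈ (Ideal (𝓞 F))⁰ :=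
          span_pair_natCast_mem_nonZeroDivisors (by split_ifs <;> omega) _
        exact ⟨hred, hI, (hCab_pos ab hred.1 hI) ▸ hC'⟩
      · rintro ⟨hred, hI, hC'⟩
        exact ⟨hred, (hCab_pos ab hred.1 hI).trans hC'⟩
  -- (2) fibrewise count of the good pairs
  have hGOODcard : (S3.card : ℝ) * ρ ≤ GOOD.card := by
    have hmaps : ∀ ab ∈ GOOD, Cab ab ∈ S3 := fun ab hab => mem_filter.2 ⟨mem_univ _, (mem_filter.1 hab).2⟩
    rw [card_eq_sum_card_fiberwise hmaps, Nat.cast_sum]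
    calc (S3.card : ℝ) * ρ = ∑ _C ∈ S3, ρ := by rw [sum_const, nsmul_eq_mul]
      _ ≤ ∑ C ∈ S3, ((GOOD.filter fun ab => Cab ab = C).card : ℝ) := sum_le_sum hfib
  -- (3) few pairs are lost to the divisor threshold
  have hsRP : ∀ ab ∈ RP, (0 < ab.1 ∧ 0 < ab.2 ∧ ab.2 ^ 2 < (NumberField.discr F).toNat ∧ 4 * ab.1 ∣ (NumberField.discr F).toNat - ab.2 ^ 2 ∧ (NumberField.discr F).toNat < (2 * ab.1 + ab.2) ^ 2 ∧ (2 * ab.1 ≤ ab.2 ∨ (2 * ab.1 - ab.2) ^ 2 < (NumberField.discr F).toNat)) := fun ab hab => (hRP ab).1 hab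
  have hLOSTcard : (LOST.card : ℝ) ≤ 2 * (Real.sqrt (NumberField.discr F).toNat * (1 + Real.log (NumberField.discr F).toNat) ^ 3) / K' := by
    have h := RealReducedPairs.threshold_mul_card_le_sqrt_mul_log h2 hpos K' RP hsRP
    rw [le_div_iff₀ (by exact_mod_cast hK'), mul_comm]
    exact_mod_cast h
  -- (4) the good retained pairs
  have hsplit : GOOD.card ≤ GR.card + LOST.card := by
    refine (card_le_card fun ab hab => ?_).trans (card_union_le _ _)
    by_cases h : ((((NumberField.discr F).toNat) - ab.2 ^ 2) / 4).divisors.card ≤ K' ^ 2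
    · exact mem_union_left _ (mem_filter.2 ⟨hab, h⟩)
    · exact mem_union_right _ (mem_filter.2 ⟨(mem_filter.1 hab).1, not_le.1 h⟩)
  refine ⟨GR, fun ab hab => ?_, ?_⟩
  · obtain ⟨hab', hτ⟩ := mem_filter.1 hab
    obtain ⟨habRP, h3⟩ := mem_filter.1 hab'
    have hred := (hRP ab).1 habRP
    have hI : Ideal.span {((if 4 ∣ (NumberField.discr F).toNat then ab.1 else 2 * ab.1 : ℕ) : 𝓞 F), ((if 4 ∣ (NumberField.discr F).toNat then ab.2 / 2 else ab.2 : ℕ) : 𝓞 F) + α} ∈ (Ideal (𝓞 F))⁰ := span_pair_natCast_mem_nonZeroDivisors (by split_ifs <;> omega) _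
    exact ⟨hred, ⟨hI, (hCab_pos ab hred.1 hI) ▸ h3⟩, hτ⟩
  · have hs : (GOOD.card : ℝ) ≤ GR.card + LOST.card := by exact_mod_cast hsplit
    linarith

/-! ### Coins hitting prescribed fields -/

/-- Reading the two fields of `natBits ℓ b ++ (natBits k j ++ t)`. [folklore] -/
theorem take_fields (ℓ k b j : ℕ) (t : List Bool) :
    (natBits ℓ b ++ (natBits k j ++ t)).take ℓ = natBits ℓ b ∧
      ((natBits ℓ b ++ (natBits k j ++ t)).drop ℓ).take k = natBits k j := by
  constructor
  · rw [List.take_append_of_le_length (by simp), List.take_of_length_le (by simp)]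
  · rw [List.drop_append_of_le_length (by simp), List.drop_eq_nil_of_le (by simp), List.nil_append,
      List.take_append_of_le_length (by simp), List.take_of_length_le (by simp)]

/-- **Coin strings with prescribed fields.** If on the finite set `GR` the map `(a, b) ↦ (b, J(a, b))` is injective
with `b < 2^ℓ`, `J < 2^k`, `ℓ + k ≤ β'`, and every string of length `β'` whose first `ℓ` bits read `b` and next `k`
bits read `J(a, b)` lies in `S`, then `S` has uniform probability `≥ #GR / 2^(ℓ+k)`. [folklore] -/
theorem coin_injection : ∀ (GR : Finset (ℕ × ℕ)) (J : ℕ × ℕ → ℕ) (ℓ k β' : ℕ), ℓ + k ≤ β' →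
    ∀ S : Set (List Bool), (∀ ab ∈ GR, ab.2 < 2 ^ ℓ ∧ J ab < 2 ^ k) →
    (∀ ab ∈ GR, ∀ ab' ∈ GR, ab.2 = ab'.2 → J ab = J ab' → ab = ab') →
    (∀ ab ∈ GR, ∀ z : List Bool, z.length = β' → bitsToNat (z.take ℓ) = ab.2 →
      bitsToNat ((z.drop ℓ).take k) = J ab → z ∈ S) →
    (GR.card : ℝ) / 2 ^ (ℓ + k) ≤ uniformProb β' S := by
  intro GR J ℓ k β' hβ S hlt hinj hS
  classical
  unfold uniformProb
  rw [div_le_div_iff₀ (by positivity) (by positivity)]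
  -- the injection `((a, b), t) ↦ natBits ℓ b ++ natBits k J ++ t`
  have hcard := card_le_card_of_injOn (fun p : (ℕ × ℕ) × List.Vector Bool (β' - (ℓ + k)) =>
      (⟨natBits ℓ p.1.2 ++ (natBits k (J p.1) ++ p.2.toList), by simp; omega⟩ : List.Vector Bool β'))
    (s := GR ×ˢ (univ : Finset (List.Vector Bool (β' - (ℓ + k)))))
    (t := univ.filter fun r : List.Vector Bool β' => r.toList ∈ S) (fun p hp => ?_) (fun p hp p' hp' h => ?_)
  · rw [card_product, card_univ, card_vector, Fintype.card_bool] at hcard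
    have h' : (GR.card : ℝ) * 2 ^ (β' - (ℓ + k)) ≤ ((univ.filter fun r : List.Vector Bool β' => r.toList ∈ S).card : ℝ) := by
      exact_mod_cast hcard
    calc (GR.card : ℝ) * 2 ^ β' = GR.card * 2 ^ (β' - (ℓ + k)) * 2 ^ (ℓ + k) := by
          rw [mul_assoc, ← pow_add, Nat.sub_add_cancel hβ]
      _ ≤ ((univ.filter fun r : List.Vector Bool β' => r.toList ∈ S).card : ℝ) * 2 ^ (ℓ + k) :=
          mul_le_mul_of_nonneg_right h' (by positivity)
  · -- lands in the good strings
    obtain ⟨hab, -⟩ := mem_product.1 (mem_coe.1 hp)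
    refine mem_coe.2 (mem_filter.2 ⟨mem_univ _, hS p.1 hab _ (by simp; omega) ?_ ?_⟩)
    · rw [List.Vector.toList_mk, (take_fields ℓ k p.1.2 (J p.1) p.2.toList).1, bitsToNat_natBits (hlt p.1 hab).1]
    · rw [List.Vector.toList_mk, (take_fields ℓ k p.1.2 (J p.1) p.2.toList).2, bitsToNat_natBits (hlt p.1 hab).2]
  · -- injective
    obtain ⟨hab, -⟩ := mem_product.1 (mem_coe.1 hp)
    obtain ⟨hab', -⟩ := mem_product.1 (mem_coe.1 hp')
    have hl := congrArg List.Vector.toList h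
    rw [List.Vector.toList_mk, List.Vector.toList_mk] at hl
    obtain ⟨hA, hBT⟩ := List.append_inj hl (by simp)
    obtain ⟨hB, hT⟩ := List.append_inj hBT (by simp)
    have hb : p.1.2 = p'.1.2 := by
      have := congrArg bitsToNat hA
      rwa [bitsToNat_natBits (hlt _ hab).1, bitsToNat_natBits (hlt _ hab').1] at this
    have hj : J p.1 = J p'.1 := by
      have := congrArg bitsToNat hB
      rwa [bitsToNat_natBits (hlt _ hab).2, bitsToNat_natBits (hlt _ hab').2] at this
    exact Prod.ext (hinj _ hab _ hab' hb hj) (Subtype.ext hT)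

end Summit.QuantumAdvantage.QuantumAdvantage.Theorems.ArithStatLadder.IqThreeMemBQP

end
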